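import Summits.QuantumFields.YangMills.Theorems.FlatTubeReductionValleyRelocalisationCore
import Summits.QuantumFields.YangMills.Theorems.FemtoCutoffLadderFixedLatticeLawValleyGain
import HarnessLib

/-!
# Valley relocalisation FROM RED's valley gain: the body of crux K1b `ValleyRelocalisation` at `(L, θ, κ)` for `κ > 1/3 − p`, conditional ONLY on a
# first-level lower bound (route `FlatTubeReduction`, item stmt-QuantumFields-25191; rung R2b1 = RECORD-label femto gap)

Seat `ym-line-ftr-p1` g2 (prover).  Proof path (ii) of the item's docstring («IMS cut at the pinning scale + the RED fleet's valley gain»), made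
honest about its two inputs:
* ★★ `valleyRelocalisation_at` — for every `L`, tube exponent `θ ∈ (0,1)`, pinning exponent `κ`, and scales `p ≤ 1/6`, `q < 1` with
  `1/3 − p < κ`: RED's `ValleyGainAt L (powScale p) (powScale q)` AND a first-level lower bound `(1 − Bλ_b)λ₀ ≤ λ₁` (eventually in `β`) imply the
  conclusion of `ValleyRelocalisation` at `(L, θ, κ)` with loss `C·(λ_b²/L)·λ₀‖ψ‖²`, given crux K2 `OffTubeSuppression` at this `L` as a (spelled-out) hypothesis
  — PROVED in the tree: discharge it with `FlatTubeReduction.offTubeSuppression_proof L`; it is kept a hypothesis so that this module stays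
  outside the route file's import cone.  Ingredients: K2 at `θ` and at `θ⋆ = max θ q`, RED's inner phase at `δ = β^{−p}` as the pinning cut-off (`relocalise_core`), and the asymptotics `ε/λ₀ = O(β^{2p−1}) = O(λ_b²)`
  (`p ≤ 1/6`, β-uniform floor `levelValue_zero_ge_uniform`), `γ = 1 − e^{−2(B+1)λ_b} ≥ (B+1)λ_b`, `ω = O(λ_b)`, `(Lβ^{−p})²/2 ≤ β^{−2/3+2κ}` (`κ > 1/3 − p`).
* ★★ `valleyRelocalisation_at_ledger` — `L ≥ 2`, `37/120 < κ < 1/3`: by RED's PROVED `valleyGainAt_ledger` (`p = 1/40`, `q = 17/20`) the ONLY remaining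
  hypothesis besides the proved K2 is the first-level lower bound `∃ B β₁, ∀ β ≥ β₁, (1 − Bλ_b(β))·λ₀(β,L) ≤ λ₁(β,L)` — the trial-function (easy) half of the fixed-lattice
  Lüscher law at level one with an arbitrary constant (for `L = 1` it is crux ONE, `oneSiteLevels_proof`; for `L ≥ 2` it is OPEN in the tree).

WHAT THIS DOES NOT GIVE: the item as filed quantifies over ALL `κ ∈ (0, 1/3)`; for `κ ≤ 1/3 − p` (RED's window: `p < 1/10`) the gain at the pinning
scale `β^{−(1/3−κ)}` is not in the tree (it is RED's VALLEY programme at finer scales, or the Airy/Agmon path (i) of the docstring).  HONEST FRAMING: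
R2b1 is a RECORD rung — nothing here concerns infinite volume, the continuum, or the Clay Yang–Mills mass gap.  No definitions, no named facts, no `sorry`.
-/

set_option autoImplicit false

noncomputable section

open MeasureTheory Filter Topology Real
open Literature.MathematicalPhysics.QuantumFieldTheory
open Literature.MathematicalPhysics.QuantumLattice

namespace Summit.QuantumFields.YangMills.Theorems.FemtoTransferGap

namespace ValleyReloc

open Summit.QuantumFields.YangMills.Theorems.FemtoTransferGap.OffTube

variable {L : ℕ} [NeZero L]

/-! ## §1 Scalar asymptotics -/

omit [NeZero L] in
/-- `λ_b(β)² ≥ β^{−2/3}` for `β > 0` (`λ_b = 2^{1/3}β^{−1/3}`). [folklore] -/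
theorem rpow_neg_two_thirds_le_bareLambda_sq {β : ℝ} (hβ : 0 < β) : β ^ (-(2 : ℝ) / 3) ≤ bareLambda β ^ 2 := by
  rw [bareLambda_eq_rpow hβ, mul_pow]
  have h1 : (β ^ (-(1 : ℝ) / 3)) ^ 2 = β ^ (-(2 : ℝ) / 3) := by
    rw [← Real.rpow_two, ← Real.rpow_mul hβ.le]; norm_num
  have h2 : (1 : ℝ) ≤ ((2 : ℝ) ^ ((1 : ℝ) / 3)) ^ 2 := one_le_pow₀ (Real.one_le_rpow (by norm_num) (by norm_num))
  rw [h1]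
  have h0 : 0 ≤ β ^ (-(2 : ℝ) / 3) := Real.rpow_nonneg hβ.le _
  nlinarith

omit [NeZero L] in
/-- For `p ≤ 1/6` and `β ≥ 1`: `β^{2p−1} ≤ λ_b(β)²`. [folklore] -/
theorem rpow_two_mul_sub_one_le_bareLambda_sq {β p : ℝ} (hβ : 1 ≤ β) (hp : p ≤ 1 / 6) : β ^ (2 * p - 1) ≤ bareLambda β ^ 2 :=
  (Real.rpow_le_rpow_of_exponent_le hβ (by linarith)).trans (rpow_neg_two_thirds_le_bareLambda_sq (by linarith))

/-- The lattice IMS defect at the cut-off scale `δ = β^{−p}` is `96π²|E|²·β^{2p−1}·c_β^{|E|} ≤ (96π²|E|²/uFC)·λ_b²·λ₀` for `p ≤ 1/6`, `β ≥ 1`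
(β-uniform floor). [cite: SimonB1983DiscreteSpectrum, §3] -/
theorem imsDefect_powScale_le {β p : ℝ} (hβ : 1 ≤ β) (hp : p ≤ 1 / 6) :
    (1 / 2) * ((Fintype.card (Edge 3 L) : ℝ) ^ 2 * (8 * π / powScale p β) ^ 2 * (3 / β) * latCE L β) ≤
      (96 * π ^ 2 * (Fintype.card (Edge 3 L) : ℝ) ^ 2 / uniformFloorConst L) * bareLambda β ^ 2 * topValue su2Rep L β := by
  have hβ0 : 0 < β := by linarith
  have hδ : powScale p β = β ^ (-p) := powScale_eq hβ
  have e1 : (β ^ p) ^ 2 = β ^ (2 * p) := by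
    rw [← Real.rpow_natCast, ← Real.rpow_mul hβ0.le]; congr 1; push_cast; ring
  have e2 : β ^ (2 * p) * (3 / β) = 3 * β ^ (2 * p - 1) := by
    rw [Real.rpow_sub_one hβ0.ne']; ring
  have h1 : (8 * π / powScale p β) ^ 2 * (3 / β) = 192 * π ^ 2 * β ^ (2 * p - 1) := by
    rw [hδ, Real.rpow_neg hβ0.le, div_inv_eq_mul, mul_pow, e1, mul_assoc, e2]; ring
  have hfl := levelValue_zero_ge_uniform (L := L) hβ
  rw [levelValue_zero] at hfl
  have huf := uniformFloorConst_pos (L := L)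
  have hlat : latCE L β ≤ topValue su2Rep L β / uniformFloorConst L := by
    rw [le_div_iff₀ huf]; linarith
  have hpow := rpow_two_mul_sub_one_le_bareLambda_sq hβ hp
  have hlat0 : 0 ≤ latCE L β := (latCE_pos hβ0.le).le
  calc (1 / 2) * ((Fintype.card (Edge 3 L) : ℝ) ^ 2 * (8 * π / powScale p β) ^ 2 * (3 / β) * latCE L β)
      = 96 * π ^ 2 * (Fintype.card (Edge 3 L) : ℝ) ^ 2 * (β ^ (2 * p - 1) * latCE L β) := by
        rw [show ((Fintype.card (Edge 3 L) : ℝ) ^ 2 * (8 * π / powScale p β) ^ 2 * (3 / β) * latCE L β) =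
          (Fintype.card (Edge 3 L) : ℝ) ^ 2 * ((8 * π / powScale p β) ^ 2 * (3 / β)) * latCE L β by ring, h1]; ring
    _ ≤ 96 * π ^ 2 * (Fintype.card (Edge 3 L) : ℝ) ^ 2 * (bareLambda β ^ 2 * (topValue su2Rep L β / uniformFloorConst L)) := by
        refine mul_le_mul_of_nonneg_left ?_ (by positivity)
        exact mul_le_mul hpow hlat hlat0 (sq_nonneg _)
    _ = (96 * π ^ 2 * (Fintype.card (Edge 3 L) : ℝ) ^ 2 / uniformFloorConst L) * bareLambda β ^ 2 * topValue su2Rep L β := by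
        field_simp

/-- Pinning scale: for `1/3 − p < κ` the near region `{∃ z, orbitDist (twist3 z U) < β^{−p}}` is Polyakov-pinned at threshold `β^{−2/3+2κ}` eventually:
`(L·β^{−p})²/2 ≤ β^{−2/3+2κ}` for all large `β`. [folklore] -/
theorem eventually_pin {p κ : ℝ} (hκp : 1 / 3 - p < κ) :
    ∃ β0 : ℝ, ∀ β : ℝ, β0 ≤ β → 1 ≤ β → ((L : ℝ) * powScale p β) ^ 2 / 2 ≤ β ^ (-(2 : ℝ) / 3 + 2 * κ) := by
  have hLpos : (0 : ℝ) < (L : ℝ) := by exact_mod_cast Nat.pos_of_ne_zero (NeZero.ne L)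
  set e : ℝ := 2 * κ - 2 / 3 + 2 * p with he
  have he0 : 0 < e := by rw [he]; linarith
  obtain ⟨β0, hβ0⟩ := powScale_eventually_le he0 (c := 2 / (L : ℝ) ^ 2) (by positivity)
  refine ⟨β0, fun β hβ hβ1 => ?_⟩
  have hβpos : 0 < β := by linarith
  have h1 : powScale e β ≤ 2 / (L : ℝ) ^ 2 := hβ0 β hβ
  rw [powScale_eq hβ1] at h1 ⊢
  have h2 : (β ^ (-p)) ^ 2 = β ^ (-e) * β ^ (-(2 : ℝ) / 3 + 2 * κ) := by
    rw [← Real.rpow_two, ← Real.rpow_mul hβpos.le, ← Real.rpow_add hβpos, he]; ring_nf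
  have h3 : (L : ℝ) ^ 2 * β ^ (-e) ≤ 2 := by
    have := mul_le_mul_of_nonneg_left h1 (sq_nonneg (L : ℝ))
    rwa [mul_div_cancel₀ _ (by positivity : (L : ℝ) ^ 2 ≠ 0)] at this
  have h4 : 0 ≤ β ^ (-(2 : ℝ) / 3 + 2 * κ) := Real.rpow_nonneg hβpos.le _
  calc ((L : ℝ) * β ^ (-p)) ^ 2 / 2 = ((L : ℝ) ^ 2 * β ^ (-e)) * β ^ (-(2 : ℝ) / 3 + 2 * κ) / 2 := by rw [mul_pow, h2]; ring
    _ ≤ 2 * β ^ (-(2 : ℝ) / 3 + 2 * κ) / 2 := by gcongr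
    _ = β ^ (-(2 : ℝ) / 3 + 2 * κ) := by ring

omit [NeZero L] in
/-- Scalar bookkeeping for the ground-state mass defect: with `λ_b ≤ γ ≤ 1`, `uFC·lat ≤ λ₀`, `7E ≤ λ_b³·uFC` and `ε ≤ C₁λ_b²λ₀`,
`E·lat/λ₀ + (2/(γλ₀))((1 + 2/γ)E·lat + ε) ≤ (1 + 2C₁)λ_b`. [folklore] -/
theorem omega_scalar_bound {E lat lam v γ u ε C₁ : ℝ} (hlam : 0 < lam) (hv : 0 < v) (hγv : v ≤ γ) (hγ1 : γ ≤ 1)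
    (hfl : u * lat ≤ lam) (hlat : 0 ≤ lat) (hE : 0 ≤ E) (hE7 : 7 * E ≤ v ^ 3 * u)
    (hε : ε ≤ C₁ * v ^ 2 * lam) (hC₁ : 0 ≤ C₁) :
    E * lat / lam + 2 / (γ * lam) * ((1 + 2 / γ) * (E * lat) + ε) ≤ (1 + 2 * C₁) * v := by
  have hγ : 0 < γ := lt_of_lt_of_le hv hγv
  have key : E * lat / lam + 2 / (γ * lam) * ((1 + 2 / γ) * (E * lat) + ε) =
      (E * lat * γ ^ 2 + 2 * (γ + 2) * (E * lat) + 2 * γ * ε) / (γ ^ 2 * lam) := by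
    field_simp
    ring
  rw [key, div_le_iff₀ (by positivity)]
  have h1 : 7 * E * lat ≤ v ^ 3 * lam :=
    calc 7 * E * lat ≤ v ^ 3 * u * lat := mul_le_mul_of_nonneg_right hE7 hlat
      _ = v ^ 3 * (u * lat) := by ring
      _ ≤ v ^ 3 * lam := mul_le_mul_of_nonneg_left hfl (by positivity)
  have h2 : v ^ 3 * lam ≤ v * γ ^ 2 * lam := by
    have : v ^ 2 ≤ γ ^ 2 := pow_le_pow_left₀ hv.le hγv 2
    have : v ^ 3 ≤ v * γ ^ 2 := by nlinarith
    exact mul_le_mul_of_nonneg_right this hlam.le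
  have h3 : E * lat * γ ^ 2 + 2 * (γ + 2) * (E * lat) ≤ 7 * E * lat := by
    have hEl : 0 ≤ E * lat := mul_nonneg hE hlat
    have hγ2 : γ ^ 2 ≤ 1 := pow_le_one₀ hγ.le hγ1
    have ha := mul_le_mul_of_nonneg_left hγ2 hEl
    have hb := mul_le_mul_of_nonneg_left hγ1 hEl
    linarith
  have h4 : 2 * γ * ε ≤ 2 * C₁ * v * (γ ^ 2 * lam) := by
    have : ε ≤ C₁ * v * γ * lam := by
      calc ε ≤ C₁ * v ^ 2 * lam := hε
        _ = C₁ * v * v * lam := by ring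
        _ ≤ C₁ * v * γ * lam := by
            refine mul_le_mul_of_nonneg_right (mul_le_mul_of_nonneg_left hγv (by positivity)) hlam.le
    nlinarith [hγ.le]
  nlinarith [h1, h2, h3, h4]

omit [NeZero L] in
/-- Scalar bookkeeping: `β²E ≤ 2u/7`, `β ≥ 1`, `λ_b³ = 2/β` give `7E ≤ λ_b³·u`. [folklore] -/
theorem seven_mul_le_of_sq_mul_le {E β v u : ℝ} (hβ : 1 ≤ β) (hE : 0 ≤ E) (h6 : β ^ 2 * E ≤ 2 * u / 7) (hv3 : v ^ 3 = 2 / β) :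
    7 * E ≤ v ^ 3 * u := by
  have hβ0 : 0 < β := by linarith
  have h1 : 7 * E * β ≤ 2 * u := by
    have hββ : β ≤ β ^ 2 := by nlinarith
    have : E * β ≤ E * β ^ 2 := mul_le_mul_of_nonneg_left hββ hE
    nlinarith
  rw [hv3, div_mul_eq_mul_div, le_div_iff₀ hβ0]
  linarith

/-! ## §2 The item's conclusion at `(L, θ, κ)` from the gain and the first-level lower bound -/

/-- ★★ **Valley relocalisation at `(L, θ, κ)` from RED's valley gain at scale `(β^{−p}, β^{−q})` (`p ≤ 1/6`, `1/3 − p < κ`, `q < 1`) and a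
first-level lower bound `(1 − Bλ_b)λ₀ ≤ λ₁`.**  The conclusion is VERBATIM the body of `FlatTubeReduction.ValleyRelocalisation` at `(L, θ, κ)`.
[cite: SimonB1983DiscreteSpectrum, §3] [cite: Luscher1983, §2–3] [cite: LuscherMunster1984, §2] [cite: ReedSimonIV1978, Thm. XIII.1] -/
theorem valleyRelocalisation_at {θ κ p q : ℝ} (hθ0 : 0 < θ) (hθ1 : θ < 1) (hp : p ≤ 1 / 6)
    (hκp : 1 / 3 - p < κ) (hq1 : q < 1)
    (hK2 : ∀ θ' : ℝ, 0 < θ' → θ' < 1 → ∃ β0 : ℝ, ∀ β : ℝ, β0 ≤ β → ∀ (Ω ψ : GaugeConfig 3 L SU2 → ℝ), IsPhys Ω →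
      (∀ U, 0 < Ω U) → transferApply β Ω = topValue su2Rep L β • Ω → IsPhys ψ → l2 ψ Ω = 0 →
      ∃ ψ' : GaugeConfig 3 L SU2 → ℝ, IsPhys ψ' ∧ l2 ψ' Ω = 0 ∧ (∀ U, β ^ (-θ') < wilsonAction su2Rep U → ψ' U = 0) ∧
        l2 ψ' ψ' ≤ l2 ψ ψ ∧ qform su2Rep β ψ ψ ≤ qform su2Rep β ψ' ψ' + bareLambda β ^ 3 / L * topValue su2Rep L β * l2 ψ ψ)
    (hGain : ValleyGainAt L (powScale p) (powScale q))
    (hLow : ∃ B β₁ : ℝ, ∀ β : ℝ, β₁ ≤ β → (1 - B * bareLambda β) * topValue su2Rep L β ≤ levelValue su2Rep L β 1) :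
    ∃ C β0 : ℝ, 0 ≤ C ∧ ∀ β : ℝ, β0 ≤ β → ∀ (Ω ψ : GaugeConfig 3 L SU2 → ℝ), IsPhys Ω → (∀ U, 0 < Ω U) →
      transferApply β Ω = topValue su2Rep L β • Ω → IsPhys ψ → l2 ψ Ω = 0 →
      (∀ U, β ^ (-θ) < wilsonAction su2Rep U → ψ U = 0) →
      (∀ φ : GaugeConfig 3 L SU2 → ℝ, IsPhys φ → l2 φ Ω = 0 → (∀ U, β ^ (-θ) < wilsonAction su2Rep U → φ U = 0) →
        qform su2Rep β φ φ * l2 ψ ψ ≤ qform su2Rep β ψ ψ * l2 φ φ) →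
      ∃ ψ' : GaugeConfig 3 L SU2 → ℝ, IsPhys ψ' ∧ l2 ψ' Ω = 0 ∧ (∀ U, β ^ (-θ) < wilsonAction su2Rep U → ψ' U = 0) ∧
        (∀ U, (∃ (x : Site 3 L) (e : Edge 3 1), β ^ (-(2 : ℝ) / 3 + 2 * κ) < 2 - |((su2Rep (polyakovSite x U e)).trace).re|) → ψ' U = 0) ∧
        l2 ψ' ψ' ≤ l2 ψ ψ ∧
        qform su2Rep β ψ ψ ≤ qform su2Rep β ψ' ψ' + C * bareLambda β ^ 2 / L * topValue su2Rep L β * l2 ψ ψ := by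
  have hLpos : (0 : ℝ) < (L : ℝ) := by exact_mod_cast Nat.pos_of_ne_zero (NeZero.ne L)
  have hLne : (L : ℝ) ≠ 0 := hLpos.ne'
  -- constants
  obtain ⟨B₀, β₁, hLowB⟩ := hLow
  set B : ℝ := max B₀ 0 with hBdef
  have hB : 0 ≤ B := le_max_right _ _
  set C₁ : ℝ := 96 * π ^ 2 * (Fintype.card (Edge 3 L) : ℝ) ^ 2 / uniformFloorConst L with hC₁
  have huf := uniformFloorConst_pos (L := L)
  have hC₁0 : 0 ≤ C₁ := by positivity
  set Cω : ℝ := 1 + 2 * C₁ with hCω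
  have hCω0 : 0 ≤ Cω := by positivity
  set K : ℝ := 16 + 8 * B * Cω + 32 * Cω ^ 2 + 8 * C₁ with hK
  have hK0 : 0 ≤ K := by positivity
  set θs : ℝ := max θ q with hθs
  have hθs0 : 0 < θs := lt_max_of_lt_left hθ0
  have hθs1 : θs < 1 := max_lt hθ1 hq1
  -- thresholds
  obtain ⟨β₂, H2⟩ := hK2 θ hθ0 hθ1
  obtain ⟨β₃, H3⟩ := hK2 θs hθs0 hθs1
  set A : ℝ := 2 * L * (B + 1) with hA
  obtain ⟨β₄, H4⟩ := hGain A
  obtain ⟨β₅, H5⟩ := eventually_pin (L := L) hκp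
  obtain ⟨β₆, H6⟩ := eventually_sq_mul_exp_le hθs1 (c := 2 * uniformFloorConst L / 7) (by positivity)
  set t₀ : ℝ := min (1 / (2 * (B + 1))) (min (1 / (8 * Cω)) (1 / (4 * (2 + B * Cω + C₁)))) with ht₀
  have ht₀pos : 0 < t₀ := by rw [ht₀]; positivity
  set β0 : ℝ := max (max (max 2 β₁) (max β₂ β₃)) (max (max β₄ β₅) (max β₆ (2 / t₀ ^ 3))) with hβ0def
  refine ⟨L * K, β0, by positivity, fun β hβ Ω ψ hΩ hΩpos heig hψ hψΩ _ hmax => ?_⟩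
  -- unpack `β ≥ β0`
  have hge : ∀ x : ℝ, x ≤ β0 → x ≤ β := fun x hx => hx.trans hβ
  have hβ2 : (2 : ℝ) ≤ β := hge _ (by rw [hβ0def]; exact le_max_of_le_left (le_max_of_le_left (le_max_left _ _)))
  have hβ1 : (1 : ℝ) ≤ β := by linarith only [hβ2]
  have hβpos : 0 < β := by linarith only [hβ2]
  have hββ₁ : β₁ ≤ β := hge _ (by rw [hβ0def]; exact le_max_of_le_left (le_max_of_le_left (le_max_right _ _)))
  have hββ₂ : β₂ ≤ β := hge _ (by rw [hβ0def]; exact le_max_of_le_left (le_max_of_le_right (le_max_left _ _)))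
  have hββ₃ : β₃ ≤ β := hge _ (by rw [hβ0def]; exact le_max_of_le_left (le_max_of_le_right (le_max_right _ _)))
  have hββ₄ : β₄ ≤ β := hge _ (by rw [hβ0def]; exact le_max_of_le_right (le_max_of_le_left (le_max_left _ _)))
  have hββ₅ : β₅ ≤ β := hge _ (by rw [hβ0def]; exact le_max_of_le_right (le_max_of_le_left (le_max_right _ _)))
  have hββ₆ : β₆ ≤ β := hge _ (by rw [hβ0def]; exact le_max_of_le_right (le_max_of_le_right (le_max_left _ _)))
  have hβt : 2 / t₀ ^ 3 ≤ β := hge _ (by rw [hβ0def]; exact le_max_of_le_right (le_max_of_le_right (le_max_right _ _)))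
  have hv0 : 0 < bareLambda β := by unfold bareLambda; exact Real.rpow_pos_of_pos (by positivity) _
  have hv1 : bareLambda β ≤ 1 := by
    unfold bareLambda
    apply Real.rpow_le_one (by positivity) _ (by norm_num)
    rw [div_le_one hβpos]; exact hβ2
  set v : ℝ := bareLambda β with hv
  have hvt : v ≤ t₀ := bareLambda_le_of_le ht₀pos hβt
  have hvB : v ≤ 1 / (2 * (B + 1)) := hvt.trans (min_le_left _ _)
  have hvω : v ≤ 1 / (8 * Cω) := hvt.trans ((min_le_right _ _).trans (min_le_left _ _))
  have hvs : v ≤ 1 / (4 * (2 + B * Cω + C₁)) := hvt.trans ((min_le_right _ _).trans (min_le_right _ _))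
  set lam : ℝ := topValue su2Rep L β with hlam
  have hlam0 : 0 < lam := topValue_su2Rep_pos L β
  -- the scales
  set δ : ℝ := powScale p β with hδdef
  have hδpos : 0 < δ := powScale_pos p β
  have hδq : β ^ (-θs) ≤ powScale q β := by
    rw [powScale_eq hβ1]; exact Real.rpow_le_rpow_of_exponent_le hβ1 (neg_le_neg (le_max_right θ q))
  have htube : β ^ (-θs) ≤ β ^ (-θ) := Real.rpow_le_rpow_of_exponent_le hβ1 (neg_le_neg (le_max_left θ q))
  have hpin : ((L : ℝ) * δ) ^ 2 / 2 ≤ β ^ (-(2 : ℝ) / 3 + 2 * κ) := H5 β hββ₅ hβ1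
  -- the gain at this `β`
  set γ : ℝ := 1 - Real.exp (-(A * bareLambda ((L : ℝ) ^ 3 * β))) with hγdef
  have hAv : A * bareLambda ((L : ℝ) ^ 3 * β) = 2 * ((B + 1) * v) := by
    rw [bareLambda_cube_mul hβpos L, hA, hv,
      show 2 * (L : ℝ) * (B + 1) * (bareLambda β / L) = 2 * (B + 1) * ((L : ℝ) * (bareLambda β / L)) by ring,
      mul_div_cancel₀ _ hLne]
    ring
  have hγ1 : γ ≤ 1 := by rw [hγdef]; linarith only [Real.exp_pos (-(A * bareLambda ((L : ℝ) ^ 3 * β)))]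
  have hx1 : (B + 1) * v ≤ 1 / 2 := by
    have h := (le_div_iff₀ (by positivity : (0 : ℝ) < 2 * (B + 1))).1 hvB
    linarith only [h]
  have hγB : (B + 1) * v ≤ γ := by
    rw [hγdef, hAv]
    -- `x ≤ 1 − e^{−2x}` for `0 ≤ x ≤ 1/2`: `e^{2x} ≥ 1 + 2x` and `1/(1+2x) ≤ 1 − x`
    have hx0 : 0 ≤ (B + 1) * v := by positivity
    have hpos : 0 < 1 + 2 * ((B + 1) * v) := by linarith only [hx0]
    have h2 : Real.exp (-(2 * ((B + 1) * v))) ≤ (1 + 2 * ((B + 1) * v))⁻¹ := by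
      rw [Real.exp_neg]
      exact inv_anti₀ hpos (by linarith only [Real.add_one_le_exp (2 * ((B + 1) * v))])
    have h3 : (1 + 2 * ((B + 1) * v))⁻¹ ≤ 1 - (B + 1) * v := by
      have hprod := mul_nonneg hx0 (sub_nonneg.2 hx1)
      rw [inv_eq_one_div, div_le_iff₀ hpos]; linarith only [hprod]
    linarith only [h2, h3]
  have hγv : v ≤ γ := le_trans (le_mul_of_one_le_left hv0.le (by linarith only [hB])) hγB
  have hγpos : 0 < γ := lt_of_lt_of_le hv0 hγv
  have hgain : ∀ f : GaugeConfig 3 L SU2 → ℝ, IsPhys f →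
      (∀ U, f U ≠ 0 → wilsonAction su2Rep U ≤ β ^ (-θs) ∧ Real.sin (innerPhase δ U) ≠ 0) →
      qform su2Rep β f f ≤ (1 - γ) * lam * l2 f f := by
    intro f hf hsupp
    have h := H4 β hββ₄ f hf fun U hU => by
      obtain ⟨hS, hsin⟩ := hsupp U hU
      exact ⟨lt_of_le_of_lt (hS.trans hδq) (by linarith only [powScale_pos q β]), forall_lt_orbitDist_of_sin_ne_zero hδpos hsin⟩
    rw [levelValue_zero] at h
    have e : Real.exp (-(A * bareLambda ((L : ℝ) ^ 3 * β))) = 1 - γ := by rw [hγdef]; ring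
    rw [e] at h
    exact h
  -- the first level
  have hlow1 : (1 - B * v) * lam ≤ levelValue su2Rep L β 1 := by
    have h := hLowB β hββ₁
    have hB₀ : B₀ ≤ B := le_max_left _ _
    have : (1 - B * v) * lam ≤ (1 - B₀ * v) * lam :=
      mul_le_mul_of_nonneg_right (by linarith only [mul_le_mul_of_nonneg_right hB₀ hv0.le]) hlam0.le
    exact this.trans h
  -- the IMS defect and the ground-state mass defect
  have hε : (1 / 2) * ((Fintype.card (Edge 3 L) : ℝ) ^ 2 * (8 * π / δ) ^ 2 * (3 / β) * latCE L β) ≤ C₁ * v ^ 2 * lam :=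
    imsDefect_powScale_le hβ1 hp
  have hfl := levelValue_zero_ge_uniform (L := L) hβ1
  rw [levelValue_zero] at hfl
  have hlat0 : 0 < latCE L β := latCE_pos hβpos.le
  set E : ℝ := Real.exp (-(β * β ^ (-θs))) with hE
  have hE0 : 0 < E := Real.exp_pos _
  have hv3 : v ^ 3 = 2 / β := by
    rw [hv, bareLambda, ← Real.rpow_natCast, ← Real.rpow_mul (by positivity)]; norm_num
  have hE7 : 7 * E ≤ v ^ 3 * uniformFloorConst L := seven_mul_le_of_sq_mul_le hβ1 hE0.le (H6 β hββ₆) hv3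
  have hω : E * latCE L β / lam + 2 / (γ * lam) * ((1 + 2 / γ) * (E * latCE L β) +
      (1 / 2) * ((Fintype.card (Edge 3 L) : ℝ) ^ 2 * (8 * π / δ) ^ 2 * (3 / β) * latCE L β)) ≤ Cω * v := by
    rw [hCω]
    exact omega_scalar_bound hlam0 hv0 hγv hγ1 hfl hlat0.le hE0.le hE7 hε hC₁0
  have hCωpos : 0 < Cω := by rw [hCω]; positivity
  have hω8 : Cω * v ≤ 1 / 8 := by
    have h := (le_div_iff₀ (by positivity : (0 : ℝ) < 8 * Cω)).1 hvω
    linarith only [h]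
  have hsmallv : v * (4 * (2 + B * Cω + C₁)) ≤ 1 :=
    (le_div_iff₀ (by positivity : (0 : ℝ) < 4 * (2 + B * Cω + C₁))).1 hvs
  -- ★ the one-coupling core
  obtain ⟨ψ', hψ', hψ'Ω, hsupp', hpin', hle', hq'⟩ :=
    relocalise_core hβ2 hδpos htube hpin hΩ hΩpos heig (H2 β hββ₂ Ω · hΩ hΩpos heig) (H3 β hββ₃ Ω · hΩ hΩpos heig)
      hgain hγ1 hB hγB hlow1 hCω0 hω8 hω hC₁0 hε hsmallv hψ hψΩ hmax
  refine ⟨ψ', hψ', hψ'Ω, hsupp', hpin', hle', hq'.trans (le_of_eq ?_)⟩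
  rw [mul_assoc (L : ℝ) K (v ^ 2), mul_div_cancel_left₀ _ hLne]

/-! ## §3 At the ledger scales: `L ≥ 2`, `37/120 < κ < 1/3`, conditional on the first-level lower bound only -/

/-- ★★ **K1b at `L ≥ 2`, `37/120 < κ < 1/3`, every `θ ∈ (0,1)`, from the first-level lower bound ALONE** (RED's PROVED `valleyGainAt_ledger` supplies the
gain at `(β^{−1/40}, β^{−17/20})`).  The conclusion is VERBATIM the body of `FlatTubeReduction.ValleyRelocalisation` at `(L, θ, κ)`.
[cite: Luscher1983, §2–3] [cite: LuscherMunster1984, §2] [cite: SimonB1983DiscreteSpectrum, §3] -/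
theorem valleyRelocalisation_at_ledger (hL : 2 ≤ L) {θ κ : ℝ} (hθ0 : 0 < θ) (hθ1 : θ < 1) (hκ0 : 37 / 120 < κ)
    (hK2 : ∀ θ' : ℝ, 0 < θ' → θ' < 1 → ∃ β0 : ℝ, ∀ β : ℝ, β0 ≤ β → ∀ (Ω ψ : GaugeConfig 3 L SU2 → ℝ), IsPhys Ω →
      (∀ U, 0 < Ω U) → transferApply β Ω = topValue su2Rep L β • Ω → IsPhys ψ → l2 ψ Ω = 0 →
      ∃ ψ' : GaugeConfig 3 L SU2 → ℝ, IsPhys ψ' ∧ l2 ψ' Ω = 0 ∧ (∀ U, β ^ (-θ') < wilsonAction su2Rep U → ψ' U = 0) ∧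
        l2 ψ' ψ' ≤ l2 ψ ψ ∧ qform su2Rep β ψ ψ ≤ qform su2Rep β ψ' ψ' + bareLambda β ^ 3 / L * topValue su2Rep L β * l2 ψ ψ)
    (hLow : ∃ B β₁ : ℝ, ∀ β : ℝ, β₁ ≤ β → (1 - B * bareLambda β) * topValue su2Rep L β ≤ levelValue su2Rep L β 1) :
    ∃ C β0 : ℝ, 0 ≤ C ∧ ∀ β : ℝ, β0 ≤ β → ∀ (Ω ψ : GaugeConfig 3 L SU2 → ℝ), IsPhys Ω → (∀ U, 0 < Ω U) →
      transferApply β Ω = topValue su2Rep L β • Ω → IsPhys ψ → l2 ψ Ω = 0 →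
      (∀ U, β ^ (-θ) < wilsonAction su2Rep U → ψ U = 0) →
      (∀ φ : GaugeConfig 3 L SU2 → ℝ, IsPhys φ → l2 φ Ω = 0 → (∀ U, β ^ (-θ) < wilsonAction su2Rep U → φ U = 0) →
        qform su2Rep β φ φ * l2 ψ ψ ≤ qform su2Rep β ψ ψ * l2 φ φ) →
      ∃ ψ' : GaugeConfig 3 L SU2 → ℝ, IsPhys ψ' ∧ l2 ψ' Ω = 0 ∧ (∀ U, β ^ (-θ) < wilsonAction su2Rep U → ψ' U = 0) ∧
        (∀ U, (∃ (x : Site 3 L) (e : Edge 3 1), β ^ (-(2 : ℝ) / 3 + 2 * κ) < 2 - |((su2Rep (polyakovSite x U e)).trace).re|) → ψ' U = 0) ∧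
        l2 ψ' ψ' ≤ l2 ψ ψ ∧
        qform su2Rep β ψ ψ ≤ qform su2Rep β ψ' ψ' + C * bareLambda β ^ 2 / L * topValue su2Rep L β * l2 ψ ψ :=
  valleyRelocalisation_at (p := 1 / 40) (q := 17 / 20) hθ0 hθ1 (by norm_num) (by linarith) (by norm_num) hK2
    (Summit.QuantumFields.YangMills.Theorems.FemtoCutoffLadder.valleyGainAt_ledger hL) hLow

/-- ★★ The same over RED's whole proved window of scales (`valleyGainAt_pow_of_two_le`): `L ≥ 2`, `0 < p < 1/10`, `4p < q < 1` and RED's auxiliary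
exponents `(r, m)`; pinning exponent `κ > 1/3 − p`; conditional on the first-level lower bound only. [cite: Luscher1983, §2–3] [cite: LuscherMunster1984, §2] -/
theorem valleyRelocalisation_at_pow (hL : 2 ≤ L) {θ κ p q r m : ℝ} (hθ0 : 0 < θ) (hθ1 : θ < 1) (hp0 : 0 < p) (hp : p < 1 / 10)
    (hpq : 4 * p < q) (hq1 : q < 1) (hr : 0 < r) (hr1 : 2 * r < 1) (hm : 0 < m) (hrq : 2 * r < q - m / 2) (hpm : p < m / 2)
    (hC : 1 + 3 * m - 3 * r < -p) (hκp : 1 / 3 - p < κ)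
    (hK2 : ∀ θ' : ℝ, 0 < θ' → θ' < 1 → ∃ β0 : ℝ, ∀ β : ℝ, β0 ≤ β → ∀ (Ω ψ : GaugeConfig 3 L SU2 → ℝ), IsPhys Ω →
      (∀ U, 0 < Ω U) → transferApply β Ω = topValue su2Rep L β • Ω → IsPhys ψ → l2 ψ Ω = 0 →
      ∃ ψ' : GaugeConfig 3 L SU2 → ℝ, IsPhys ψ' ∧ l2 ψ' Ω = 0 ∧ (∀ U, β ^ (-θ') < wilsonAction su2Rep U → ψ' U = 0) ∧
        l2 ψ' ψ' ≤ l2 ψ ψ ∧ qform su2Rep β ψ ψ ≤ qform su2Rep β ψ' ψ' + bareLambda β ^ 3 / L * topValue su2Rep L β * l2 ψ ψ)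
    (hLow : ∃ B β₁ : ℝ, ∀ β : ℝ, β₁ ≤ β → (1 - B * bareLambda β) * topValue su2Rep L β ≤ levelValue su2Rep L β 1) :
    ∃ C β0 : ℝ, 0 ≤ C ∧ ∀ β : ℝ, β0 ≤ β → ∀ (Ω ψ : GaugeConfig 3 L SU2 → ℝ), IsPhys Ω → (∀ U, 0 < Ω U) →
      transferApply β Ω = topValue su2Rep L β • Ω → IsPhys ψ → l2 ψ Ω = 0 →
      (∀ U, β ^ (-θ) < wilsonAction su2Rep U → ψ U = 0) →
      (∀ φ : GaugeConfig 3 L SU2 → ℝ, IsPhys φ → l2 φ Ω = 0 → (∀ U, β ^ (-θ) < wilsonAction su2Rep U → φ U = 0) →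
        qform su2Rep β φ φ * l2 ψ ψ ≤ qform su2Rep β ψ ψ * l2 φ φ) →
      ∃ ψ' : GaugeConfig 3 L SU2 → ℝ, IsPhys ψ' ∧ l2 ψ' Ω = 0 ∧ (∀ U, β ^ (-θ) < wilsonAction su2Rep U → ψ' U = 0) ∧
        (∀ U, (∃ (x : Site 3 L) (e : Edge 3 1), β ^ (-(2 : ℝ) / 3 + 2 * κ) < 2 - |((su2Rep (polyakovSite x U e)).trace).re|) → ψ' U = 0) ∧
        l2 ψ' ψ' ≤ l2 ψ ψ ∧
        qform su2Rep β ψ ψ ≤ qform su2Rep β ψ' ψ' + C * bareLambda β ^ 2 / L * topValue su2Rep L β * l2 ψ ψ :=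
  valleyRelocalisation_at hθ0 hθ1 (by linarith) hκp hq1 hK2
    (Summit.QuantumFields.YangMills.Theorems.FemtoCutoffLadder.valleyGainAt_pow_of_two_le hL hp0 hp hpq hr hr1 hm hrq hpm hC) hLow

end ValleyReloc

end Summit.QuantumFields.YangMills.Theorems.FemtoTransferGap

end
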